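import Literature.Geometry.ComplexAnalytic.RelativeExponentialChartFibreComparison
import Literature.Geometry.Kaehler.ComplexTorusBijectiveHolomorphicMap
import Literature.Geometry.Kaehler.ComplexTorusSiegelNormalForm
import Literature.AlgebraicGeometry.HodgeTheory.AbelianVarietyHodgeFullnessHolds
import Literature.NumberTheory.Transcendental.AnalytificationFunctorialityProofs
import Literature.AlgebraicGeometry.AbelianSchemes.AbelianSchemeOverFibreDim
import Literature.AlgebraicGeometry.AbelianSchemes.AbelianSchemeTotalSpaceSmoothProjective
import Literature.AlgebraicGeometry.AbelianSchemes.AbelianSchemeFibreHom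
import Literature.AlgebraicGeometry.Motives.AbelianVarietyProofs
import HarnessLib

/-!
# The group law of a normalised relative exponential chart: each fibre torus is an ADDITIVE analytification of the algebraic fibre
# ([MumfordAV1970] §1 (1)–(2); [BirkenhakeLange2004] §1.2 Prop. 1.2.1; [SerreGAGA1956] §2 n°5; [DeligneHodgeII1971] §4.4 (4.4.2))

Layer `Literature/Geometry/ComplexAnalytic`, namespace `Literature.Geometry.ComplexAnalytic`.  THEOREMS ONLY (no definition, no named
fact, no instance, no notation, no `sorry`).  Cell `hodgecm-mathlib` (D-0151), FLOOR 0, P6 «MOD» (crux hLiu418 = stmt-HodgeConjecture-24832,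
`--supports`), «L8-PREP»: organ **O4 `stub_FIBREGRP`** of LA1-plan (g2)'s HOME closer skeleton `StubRELEXP` (ED. 5 dcde5a59 :385; letter =
the body of `FIBREGRP`, binder for binder), payer LA5-p01 (g2) (deal 04:15:56Z; census 04:21:59Z).  The statement is (G), the second conjunct
of the printed fact ★ P-1 `relativeExponentialUniformisation` ([DeligneHodgeII1971] §4.4 (4.4.2) p. 50), derived from the FIRST (the chart)
plus the NORMALISATION of the chart at the identity section.  HC_CM is proved only modulo the 7 printed citations (2 remaining: hLiu418 =
stmt-HodgeConjecture-24832, h413 = stmt-HodgeConjecture-24833) until rung 0 closes; this file is generic (any abelian scheme over a smooth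
complex base) and count-neutral.

THE MATHEMATICS.  Let `A → S` be an abelian scheme of relative dimension `g` over a smooth separated `ℂ`-scheme `S` of finite type,
`φS : MS → S(ℂ)`, `φA : MA → A(ℂ)` analytifications (★ `Transcendental.IsAnalytification`), and `(Φ, ex)` a relative exponential chart (★
`IsRelExpChartOn`) of the analytic projection `basePoint hS A φA : MA → MS` over an open `U`, NORMALISED: `ex (u, 0)` is the identity of the
fibre `A_{φS u}` for `u ∈ U`.  Then for every `u ∈ U` the fibre torus `X_u = ℂ^g ∕ Φ u (ℤ^{2g})` (★ `ComplexTorus (Φ u)`) is, read in the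
algebraic fibre `A_{φS u}` through ★ `AbelianSchemeOver.fibrePointToLeft`, an ADDITIVE ANALYTIFICATION of that complex abelian variety,
compatible with `φA`.  Proof ([MumfordAV1970] §1: «a compact connected complex Lie group is a complex torus»; [BirkenhakeLange2004] §1.2
Prop. 1.2.1: «a holomorphic map of complex tori fixing `0` is a homomorphism»; [SerreGAGA1956] §2 n°5: functoriality of `X ↦ X^h`):
(1) ★ (U) `complexAbelianVariety_torusUniformised_holds` uniformises the ONE fibre `A_{φS u}` additively by some torus `ComplexTorus Ψ` (map `ψ`);
(2) the fibre inclusion `A_{φS u} ↪ A` over `Spec ℂ`, read through `ψ` and `φA`, is a holomorphic map `F : ComplexTorus Ψ → MA` (★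
`IsAnalytification.mdifferentiable_comp_map_holds`), a bijection onto the fibre `basePoint⁻¹ u`;
(3) holomorphy OUT of `MA` along the fibre is tested through the étale local inverses of `ex` (§1, the template of ★
`IsRelExpChartOn.exists_mdifferentiable_fibreComparison`): `F = fibreMap u ∘ T'` for a holomorphic bijection `T' : ComplexTorus Ψ → ComplexTorus (Φ u)`
with `T' 0 = 0` by the normalisation;
(4) RIGIDITY ★ `ComplexTorus.exists_addHomeomorph_of_bijective_mdifferentiable`: `T'` is an additive homeomorphism `T` with holomorphic inverse;
(5) `φu := ψ ∘ T⁻¹` is an analytification (★ `isAnalytification_comp_homeomorph`), additive, and reads `ex (u, ·)` through `fibrePointToLeft`.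

* §1 `IsRelExpChartOn.exists_mdifferentiable_fibreLift` — a holomorphic map into the total space landing in one fibre over `U` factors
  HOLOMORPHICALLY through the fibre torus.
* §2 **`exists_additive_isAnalytification_fibre_of_isRelExpChartOn`** — THE ORGAN (G): the body of `FIBREGRP`, binder for binder.

Why it might fail as typed: the normalisation hypothesis is essential (an un-normalised chart reads a translate, not a homomorphism) — it is
used exactly once, to pin `T' 0 = 0`.

## References
* [MumfordAV1970] D. Mumford, *Abelian Varieties* (1970), §1 (1)–(2).
* [BirkenhakeLange2004] C. Birkenhake, H. Lange, *Complex Abelian Varieties*, 2nd ed. (2004), §1.2 Prop. 1.2.1 (p. 10).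
* [LangeBirkenhake1992] H. Lange, Ch. Birkenhake, *Complex Abelian Varieties* (1992), Lemma 1.1.3 and Prop. 1.1.6.
* [SerreGAGA1956] J.-P. Serre, *Géométrie algébrique et géométrie analytique*, Ann. Inst. Fourier 6 (1956), §2 n°5 p. 9.
* [DeligneHodgeII1971] P. Deligne, *Théorie de Hodge II*, Publ. Math. IHÉS 40 (1971), §4.4 (4.4.2) p. 50.
-/

set_option autoImplicit false

noncomputable section

open scoped Manifold ContDiff Topology
open Set Function Filter CategoryTheory CategoryTheory.Limits AlgebraicGeometry
open Literature.Geometry.Kaehler (ComplexTorus isAnalytification_comp_homeomorph)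
open Literature.Geometry.Kaehler.ComplexTorus (cover)
open Literature.NumberTheory.Transcendental (IsAnalytification)
open Literature.AlgebraicGeometry.Motives (SchemeOver AlgPoints ComplexPoints AbelianVariety specOver)
open Literature.AlgebraicGeometry.AbelianSchemes (AbelianSchemeOver)
open Literature.AlgebraicGeometry.HodgeTheory (complexAbelianVariety_torusUniformised_holds)

namespace Literature.Geometry.ComplexAnalytic

/-! ### §1 Holomorphic maps into one fibre factor holomorphically through the fibre torus -/

namespace IsRelExpChartOn

variable {EB : Type*} [NormedAddCommGroup EB] [NormedSpace ℂ EB] {B : Type*} [TopologicalSpace B] [ChartedSpace EB B]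
  {E : Type*} [NormedAddCommGroup E] [NormedSpace ℂ E] {ι : Type*} [Fintype ι]
  {EM : Type*} [NormedAddCommGroup EM] [NormedSpace ℂ EM] {M : Type*} [TopologicalSpace M] [ChartedSpace EM M]
  {EN : Type*} [NormedAddCommGroup EN] [NormedSpace ℂ EN] {N : Type*} [TopologicalSpace N] [ChartedSpace EN N]
  {p : M → B} {U : Set B} {Φ : B → ((ι → ℝ) ≃L[ℝ] E)} {ex : B × E → M}

/-- **A holomorphic map into the total space landing in ONE fibre over `U` factors holomorphically through the fibre torus.**  For a
relative exponential chart `h` over `U`, `b ∈ U`, and a holomorphic `F : N → M` with `p ∘ F ≡ b`, there is a holomorphic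
`T : N → ComplexTorus (Φ b)` with `fibreMap b ∘ T = F`: locally `T = π ∘ pr₂ ∘ e⁻¹ ∘ F` for a local holomorphic inverse `e` of `ex`
(the étale clause; holomorphy OUT of `M` is tested through the local inverses).  [cite: LangeBirkenhake1992, Lemma 1.1.3 and Proposition 1.1.6] -/
theorem exists_mdifferentiable_fibreLift (h : IsRelExpChartOn EB EM p U Φ ex) {F : N → M}
    (hF : MDifferentiable 𝓘(ℂ, EN) 𝓘(ℂ, EM) F) {b : B} (hb : b ∈ U) (hFb : ∀ n, p (F n) = b) :
    ∃ T : N → ComplexTorus (Φ b), (∀ n, h.fibreMap b (T n) = F n) ∧ MDifferentiable 𝓘(ℂ, EN) 𝓘(ℂ, E) T := by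
  -- every image point lies on the fibre over `b`, which is the range of the fibre map
  have hmem : ∀ n, F n ∈ range (h.fibreMap b) := fun n ↦ by
    rw [h.range_fibreMap hb, mem_preimage, mem_singleton_iff]
    exact hFb n
  choose T hT using hmem
  refine ⟨T, hT, fun n₀ ↦ ?_⟩
  -- a lift `z₀` of `T n₀` and a local inverse of the chart at `(b, z₀)`
  obtain ⟨z₀, hz₀⟩ := ComplexTorus.cover_surjective (Φ b) (T n₀)
  obtain ⟨e, htgt, hd, hexm, -, hp1, -⟩ := h.exists_local_lift hb z₀
  have hm₀ : F n₀ ∈ e.target := by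
    have h1 : F n₀ = ex (b, z₀) := by rw [← hT n₀, ← hz₀, h.fibreMap_cover hb]
    rw [h1]
    exact htgt
  -- local formula for `T`
  have hloc : ∀ n, F n ∈ e.target → T n = cover (Φ b) (e.symm (F n)).2 := by
    intro n hn
    apply h.fibreMap_injective hb
    rw [hT n, h.fibreMap_cover hb]
    set q := e.symm (F n) with hq
    have h1 : ex q = F n := hexm _ hn
    have h2 : q.1 = b := by rw [hq, hp1 _ hn, hFb n]
    calc F n = ex q := h1.symm
      _ = ex (q.1, q.2) := rfl
      _ = ex (b, q.2) := by rw [h2]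
  have hev : T =ᶠ[𝓝 n₀] fun n ↦ cover (Φ b) (e.symm (F n)).2 := by
    filter_upwards [hF.continuous.continuousAt.preimage_mem_nhds (e.open_target.mem_nhds hm₀)] with n hn
    exact hloc n hn
  refine MDifferentiableAt.congr_of_eventuallyEq ?_ hev
  -- the local formula is a composition of holomorphic maps
  have h2 : MDifferentiableAt 𝓘(ℂ, EM) (𝓘(ℂ, EB).prod 𝓘(ℂ, E)) e.symm (F n₀) :=
    (hd _ hm₀).mdifferentiableAt (e.open_target.mem_nhds hm₀)
  have h3 : MDifferentiableAt (𝓘(ℂ, EB).prod 𝓘(ℂ, E)) 𝓘(ℂ, E) (Prod.snd : B × E → E) (e.symm (F n₀)) :=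
    mdifferentiableAt_snd
  have h4 : MDifferentiableAt 𝓘(ℂ, E) 𝓘(ℂ, E) (cover (Φ b)) (e.symm (F n₀)).2 :=
    ComplexTorus.mdifferentiable_cover (Φ b) _
  have h12 : MDifferentiableAt 𝓘(ℂ, EN) (𝓘(ℂ, EB).prod 𝓘(ℂ, E)) (fun n ↦ e.symm (F n)) n₀ := h2.comp n₀ (hF n₀)
  have h123 : MDifferentiableAt 𝓘(ℂ, EN) 𝓘(ℂ, E) (fun n ↦ (e.symm (F n)).2) n₀ := h3.comp n₀ h12
  show MDifferentiableAt 𝓘(ℂ, EN) 𝓘(ℂ, E) (cover (Φ b) ∘ fun n ↦ (e.symm (F n)).2) n₀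
  exact h4.comp n₀ h123

end IsRelExpChartOn

/-! ### §2 The organ (G): the fibre torus of a normalised chart is an additive analytification of the algebraic fibre -/

/-- **O4 «FIBREGRP» — THE GROUP LAW OF A NORMALISED RELATIVE EXPONENTIAL CHART.**  For an abelian scheme `A → S` of relative dimension `g`
over a smooth separated `ℂ`-scheme `S` of finite type and relative dimension `d`, analytifications `φS : MS → S(ℂ)`, `φA : MA → A(ℂ)`, and a
relative exponential chart `(Φ, ex)` of `basePoint hS A φA : MA → MS` over `U` (★ `IsRelExpChartOn`) NORMALISED at the identity section
(`(φA (ex (u, 0))).left = fibrePointToLeft (φS u).left 1` for `u ∈ U`): for every `u ∈ U` there is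
`φu : ComplexTorus (Φ u) → A_{φS u}(ℂ)` which is an `IsAnalytification`, ADDITIVE, and reads `ex (u, ·)` through ★ `fibrePointToLeft` —
P-1's second conjunct verbatim (the body of LA1-plan (g2)'s `FIBREGRP`, binder for binder).  Proof: (U) on the one fibre, GAGA functoriality
for the fibre inclusion, holomorphy out of `MA` through the étale local inverses (§1), rigidity of bijective holomorphic torus maps fixing
`0` (★ `ComplexTorus.exists_addHomeomorph_of_bijective_mdifferentiable`), transport of the analytification along the additive biholomorphism.
[cite: MumfordAV1970, §1 (1)–(2)] [cite: BirkenhakeLange2004, §1.2 Prop. 1.2.1 (p. 10)] [cite: SerreGAGA1956, §2 n°5 p. 9]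
[cite: DeligneHodgeII1971, §4.4 (4.4.2) p. 50] -/
theorem exists_additive_isAnalytification_fibre_of_isRelExpChartOn
    (S : SchemeOver ℂ) (d : ℕ) [LocallyOfFiniteType S.hom] [IsSeparated S.hom] [SmoothOfRelativeDimension d S.hom]
    (A : AbelianSchemeOver S.left) (g : ℕ) (hA : A.IsOfRelDim g)
    (MS : Type) [TopologicalSpace MS] [ChartedSpace (Fin d → ℂ) MS] [IsManifold 𝓘(ℂ, Fin d → ℂ) ω MS]
    (φS : MS → ComplexPoints S) (hS : IsAnalytification (Fin d → ℂ) S d φS)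
    (MA : Type) [TopologicalSpace MA] [ChartedSpace (Fin (d + g) → ℂ) MA] [IsManifold 𝓘(ℂ, Fin (d + g) → ℂ) ω MA]
    (φA : MA → ComplexPoints (totalOver S A)) (hφA : IsAnalytification (Fin (d + g) → ℂ) (totalOver S A) (d + g) φA)
    (U : Set MS) (Φ : MS → ((Fin g ⊕ Fin g → ℝ) ≃L[ℝ] (Fin g → ℂ))) (ex : MS × (Fin g → ℂ) → MA)
    (hex : IsRelExpChartOn (Fin d → ℂ) (Fin (d + g) → ℂ) (basePoint hS A φA) U Φ ex)
    (hnorm : ∀ u ∈ U, (φA (ex (u, 0))).left = A.fibrePointToLeft (φS u).left 1)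
    (u : MS) (hu : u ∈ U) :
    ∃ φu : ComplexTorus (Φ u) → (A.fibre (φS u).left).toAbelianVariety.Points ℂ,
      IsAnalytification (Fin g → ℂ) (A.fibre (φS u).left).toAbelianVariety.X g φu ∧
      (∀ x y, φu (x + y) = φu x * φu y) ∧
      ∀ z : Fin g → ℂ, (φA (ex (u, z))).left = A.fibrePointToLeft (φS u).left (φu (cover (Φ u) z)) := by
  classical
  set s : Spec (.of ℂ) ⟶ S.left := (φS u).left with hs
  /- (0) the algebraic fibre `A_{φS u}`, its dimension, and its torus uniformisation (U) -/
  have hdim : (A.fibre s).toAbelianVariety.dim = g := AbelianSchemeOver.dim_fibre_of_isOfRelDim hA _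
  obtain ⟨κ, _instκ, _decκ, Ψ, ψ, hψ, hψadd⟩ :=
    complexAbelianVariety_torusUniformised_holds (A.fibre s).toAbelianVariety
  haveI : FiniteDimensional ℂ (Fin (A.fibre s).toAbelianVariety.dim → ℂ) := inferInstance
  /- (1) the base point is a section of `S → Spec ℂ`, and the fibre inclusion is a morphism over `Spec ℂ` -/
  have hw : s ≫ S.hom = 𝟙 (Spec (.of ℂ)) := by
    have h1 : s ≫ S.hom = (specOver ℂ ℂ).hom := Over.w (φS u)
    have h2 : (specOver ℂ ℂ).hom = 𝟙 (Spec (.of ℂ)) := by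
      change Spec.map (CommRingCat.ofHom (algebraMap ℂ ℂ)) = _
      rw [Algebra.algebraMap_self, CommRingCat.ofHom_id, Spec.map_id]
    exact h1.trans h2
  let j : (A.fibre s).toAbelianVariety.X ⟶ totalOver S A :=
    Over.homMk (pullback.fst A.X.hom s) (by
      change pullback.fst A.X.hom s ≫ A.X.hom ≫ S.hom = pullback.snd A.X.hom s
      rw [← Category.assoc, pullback.condition, Category.assoc, hw, Category.comp_id])
  have hj : ∀ P : (A.fibre s).toAbelianVariety.Points ℂ,
      (AlgPoints.map j P).left = A.fibrePointToLeft s P := fun P ↦ rfl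
  /- (2) the torus of (U) read in `MA` through the fibre inclusion -/
  let F : ComplexTorus Ψ → MA := fun τ ↦ hφA.homeomorph.symm (AlgPoints.map j (ψ τ))
  have hFφ : ∀ τ, φA (F τ) = AlgPoints.map j (ψ τ) := fun τ ↦ hφA.homeomorph.apply_symm_apply _
  have hFread : ∀ τ, (φA (F τ)).left = A.fibrePointToLeft s (ψ τ) := fun τ ↦ by rw [hFφ, hj]
  -- holomorphy: GAGA functoriality for the fibre inclusion
  have hFhol : MDifferentiable 𝓘(ℂ, Fin (A.fibre s).toAbelianVariety.dim → ℂ) 𝓘(ℂ, Fin (d + g) → ℂ) F := by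
    haveI : LocallyOfFiniteType (A.fibre s).toAbelianVariety.X.hom :=
      (A.fibre s).toAbelianVariety.isProper.toLocallyOfFiniteType
    haveI : SmoothOfRelativeDimension (A.fibre s).toAbelianVariety.dim
        (A.fibre s).toAbelianVariety.X.hom :=
      (A.fibre s).toAbelianVariety.smoothOfRelativeDimension_dim
    haveI : SmoothOfRelativeDimension g A.X.hom := hA
    haveI : SmoothOfRelativeDimension (d + g) (totalOver S A).hom := A.smoothOfRelativeDimension_total hA
    haveI : LocallyOfFiniteType A.X.hom := A.isProper.toLocallyOfFiniteType
    haveI : LocallyOfFiniteType (totalOver S A).hom := by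
      change LocallyOfFiniteType (A.X.hom ≫ S.hom)
      infer_instance
    refine IsAnalytification.mdifferentiable_comp_map_holds hψ hφA j F ?_
    funext τ
    simp only [Function.comp_apply]
    exact hFφ τ
  /- (3) `F` is a bijection onto the fibre `basePoint⁻¹ u` -/
  have hbase : ∀ a : MA, basePoint hS A φA a = u ↔ (φA a).left ≫ A.X.hom = s := by
    intro a
    constructor
    · intro h
      have h1 : φS (basePoint hS A φA a) = AlgPoints.map (projOver S A) (φA a) := apply_basePoint hS A φA a
      rw [h] at h1
      have h2 := congrArg (fun P : ComplexPoints S => P.left) h1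
      simpa [AlgPoints.map] using h2.symm
    · intro h
      apply hS.homeomorph.injective
      rw [IsAnalytification.coe_homeomorph, apply_basePoint hS A φA a]
      apply Over.OverMorphism.ext
      simpa [AlgPoints.map] using h
  have hFbase : ∀ τ, basePoint hS A φA (F τ) = u := fun τ ↦ (hbase _).2 (by
    rw [hFread]
    exact A.fibrePointToLeft_comp_hom _ _)
  have hFinj : Injective F := by
    intro τ₁ τ₂ hτ
    have h1 : φA (F τ₁) = φA (F τ₂) := by rw [hτ]
    have h2 : A.fibrePointToLeft s (ψ τ₁) = A.fibrePointToLeft s (ψ τ₂) := by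
      rw [← hFread, ← hFread, h1]
    exact hψ.isHomeomorph.injective (A.fibrePointToLeft_injective _ h2)
  have hFsurj : ∀ a : MA, basePoint hS A φA a = u → ∃ τ, F τ = a := by
    intro a ha
    have hz : (φA a).left ≫ A.X.hom = s := (hbase a).1 ha
    have hz' : (φA a).left ≫ A.X.hom = 𝟙 _ ≫ s := by rw [hz, Category.id_comp]
    let P : (A.fibre s).toAbelianVariety.Points ℂ :=
      AlgPoints.mk (pullback.lift (φA a).left (𝟙 _) hz') (by
        change pullback.lift _ _ _ ≫ pullback.snd A.X.hom _ = _
        rw [pullback.lift_snd, Algebra.algebraMap_self, CommRingCat.ofHom_id, Spec.map_id])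
    have hP : A.fibrePointToLeft s P = (φA a).left := pullback.lift_fst _ _ _
    obtain ⟨τ, hτ⟩ := hψ.isHomeomorph.surjective P
    refine ⟨τ, hφA.isHomeomorph.injective (Over.OverMorphism.ext ?_)⟩
    rw [hFread, hτ, hP]
  /- (4) the comparison of tori `T' : ComplexTorus Ψ → ComplexTorus (Φ u)`, `fibreMap u ∘ T' = F`: holomorphic (§1), bijective,
  and `T' 0 = 0` by the NORMALISATION -/
  obtain ⟨T', hT'F, hT'hol⟩ := hex.exists_mdifferentiable_fibreLift hFhol hu hFbase
  have hT'inj : Injective T' := fun τ₁ τ₂ hτ ↦ hFinj (by rw [← hT'F, ← hT'F, hτ])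
  have hT'surj : Surjective T' := fun x ↦ by
    obtain ⟨τ, hτ⟩ := hFsurj (hex.fibreMap u x) (hex.p_fibreMap hu x)
    exact ⟨τ, hex.fibreMap_injective hu (by rw [hT'F, hτ])⟩
  have hψ0 : ψ 0 = 1 := by
    have h := hψadd 0 0
    rw [add_zero] at h
    have h' : ψ 0 * ψ 0 = ψ 0 * 1 := by rw [mul_one]; exact h.symm
    exact mul_left_cancel h'
  have hF0 : F 0 = ex (u, 0) := by
    refine hφA.isHomeomorph.injective (Over.OverMorphism.ext ?_)
    rw [hFread, hψ0, hnorm u hu]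
  have hT'0 : T' 0 = 0 := by
    apply hex.fibreMap_injective hu
    rw [hT'F, hF0, ← ComplexTorus.cover_zero (Φ u), hex.fibreMap_cover hu]
  /- (5) rigidity: `T'` is an additive homeomorphism with holomorphic inverse -/
  obtain ⟨T, -, hTT', hTadd, -, hTsymm, -, -, -, -⟩ :=
    ComplexTorus.exists_addHomeomorph_of_bijective_mdifferentiable hT'hol ⟨hT'inj, hT'surj⟩ hT'0
  have hTsymm_add : ∀ x y, T.symm (x + y) = T.symm x + T.symm y := by
    intro x y
    apply T.injective
    rw [T.apply_symm_apply, hTadd, T.apply_symm_apply, T.apply_symm_apply]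
  /- (6) the additive analytification `φu := ψ ∘ T⁻¹` -/
  refine ⟨fun x ↦ ψ (T.symm x), ?_, fun x y ↦ ?_, fun z ↦ ?_⟩
  · have h1 : IsAnalytification (Fin g → ℂ) (A.fibre s).toAbelianVariety.X
        (A.fibre s).toAbelianVariety.dim (ψ ∘ T.symm) :=
      isAnalytification_comp_homeomorph hψ T.symm hTsymm (by rw [hdim]; simp)
    exact ⟨h1.isHomeomorph, h1.finrank_eq.trans hdim, h1.mdifferentiableOn_evalOrZero⟩
  · show ψ (T.symm (x + y)) = ψ (T.symm x) * ψ (T.symm y)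
    rw [hTsymm_add, hψadd]
  · have h1 : F (T.symm (cover (Φ u) z)) = ex (u, z) := by
      rw [← hT'F, ← hTT', Homeomorph.apply_symm_apply, hex.fibreMap_cover hu]
    show (φA (ex (u, z))).left = A.fibrePointToLeft s (ψ (T.symm (cover (Φ u) z)))
    rw [← h1, hFread]

end Literature.Geometry.ComplexAnalytic

end
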